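import Summits.QuantumFields.YangMills.Theorems.FlatTubeReductionDiagonalRatioEventually
import Summits.QuantumFields.YangMills.Theorems.FlatTubeReductionProfileInterfaceMoment
import HarnessLib

/-!
# Numerology of the exact dressing at the level `T = β^{1/8}`: exponential-beats-polynomial, and the slow-window smallness of `slow_core_tail_le` at `D = T/(4β)`, `ε = (√β)⁻¹`
# (route `FlatTubeReduction`, crux K1 `NearFlatRatioLaw` stmt-QuantumFields-24720; seat `ym-line-ftr-p1` g14; rate twin «ratepack-v3 / frozen fibres»; R2b1 RECORD rung — no summit
# statement is proved here)

WHY (memo `Cruxes/NearFlatRatioLaw/Lines/ratepack-v3-frozen-g12.md` §7; the real-analysis half of F8d-4 `…ExactDressingOfProfileNumbers`).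
* `exp_neg_rpow_eighth_mul_pow_le` — `e^{−cβ^{1/8}}·β^k ≤ β^{-3/4}` eventually (`x^m e^{-x} → 0`), so every Gaussian tail at `T = β^{1/8}` is `O(β^{-3/4}) = O(L²λ_b(L³β)²)`;
* `sqrt_le_self_of_one_le`;
* ★ `slow_window_numerology` — on the window `orbitDist u < D_w·recordDelta1 L (1/6) β` the three smallness conditions of `slow_core_tail_le` hold eventually at `T = β^{1/8}`,
  `D = T/(4β)`, `ε = (√β)⁻¹` (`Φ = O(β^{-7/16})`, `βτ_u²Φ² = O(β^{-5/24}) ≪ T`), together with `12L³orbitDist⁴ < 2`, `√β·3orbitDist ≤ 3c_δβ`, `β ≥ 900`, `βε² ≤ 1`,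
  `e^{−βD/2} = e^{−T/8}`.
HONEST FRAMING: real-analysis numerology; femto rung R2b1 (RECORD label); not infinite volume, not a gap, not Clay.  No defs, no named facts, no `sorry`.
-/

set_option autoImplicit false

noncomputable section

open MeasureTheory Filter Topology Real Set
open scoped BigOperators
open Literature.MathematicalPhysics.QuantumFieldTheory
open Literature.MathematicalPhysics.QuantumLattice

namespace Summit.QuantumFields.YangMills.Theorems.FemtoTransferGap.RateTube

open Summit.QuantumFields.YangMills.Theorems.FemtoTransferGap
open Summit.QuantumFields.YangMills.Theorems.FemtoTransferGap.TwoLattice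
open Summit.QuantumFields.YangMills.Theorems.FemtoTransferGap.TwoLattice.ConstTube
open Summit.QuantumFields.YangMills.Theorems.FemtoTransferGap.TwoLattice.Avg
open Summit.QuantumFields.YangMills.Theorems.FemtoTransferGap.TwoLattice.Cov
open Summit.QuantumFields.YangMills.Theorems.FemtoTransferGap.TwoLattice.Stiff (LinkSpace)
open Summit.QuantumFields.YangMills.Theorems.FemtoCutoffLadder

/-! ## §1 Exponential beats polynomial at the level `T = β^{1/8}` -/

section Decay

/-- `e^{−cβ^{1/8}}·β^k ≤ β^{-3/4}` eventually (`c > 0`, `k : ℕ`). [folklore] -/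
theorem exp_neg_rpow_eighth_mul_pow_le {c : ℝ} (hc : 0 < c) (k : ℕ) :
    ∀ᶠ β : ℝ in atTop, Real.exp (-(c * β ^ ((1 : ℝ) / 8))) * β ^ k ≤ β ^ (-((3 : ℝ) / 4)) := by
  -- `x^{8k+8} e^{-x} → 0` along `x = cβ^{1/8} → ∞`
  have hx : Tendsto (fun β : ℝ => c * β ^ ((1 : ℝ) / 8)) atTop atTop := (tendsto_rpow_atTop (by norm_num : (0 : ℝ) < 1 / 8)).const_mul_atTop hc
  have hφ := (Real.tendsto_pow_mul_exp_neg_atTop_nhds_zero (8 * k + 8)).comp hx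
  have hev : ∀ᶠ β : ℝ in atTop, (c * β ^ ((1 : ℝ) / 8)) ^ (8 * k + 8) * Real.exp (-(c * β ^ ((1 : ℝ) / 8))) ≤ c ^ (8 * k + 8) :=
    hφ.eventually (eventually_le_nhds (by positivity))
  filter_upwards [hev, Filter.eventually_ge_atTop (1 : ℝ)] with β hβ hβ1
  have hβ0 : 0 < β := by linarith
  have hT0 : 0 < β ^ ((1 : ℝ) / 8) := Real.rpow_pos_of_pos hβ0 _
  -- `(β^{1/8})^{8k+8} = β^{k+1}`
  have hpow : (β ^ ((1 : ℝ) / 8)) ^ (8 * k + 8) = β ^ (k + 1) := by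
    rw [← Real.rpow_natCast (β ^ ((1 : ℝ) / 8)) (8 * k + 8), ← Real.rpow_mul hβ0.le, ← Real.rpow_natCast β (k + 1)]
    congr 1; push_cast; ring
  rw [mul_pow, hpow] at hβ
  have hck : 0 < c ^ (8 * k + 8) := by positivity
  -- `β^{k+1} e^{-x} ≤ 1`
  have h1 : β ^ (k + 1) * Real.exp (-(c * β ^ ((1 : ℝ) / 8))) ≤ 1 := by
    refine le_of_mul_le_mul_left ?_ hck
    calc c ^ (8 * k + 8) * (β ^ (k + 1) * Real.exp (-(c * β ^ ((1 : ℝ) / 8)))) = c ^ (8 * k + 8) * β ^ (k + 1) * Real.exp (-(c * β ^ ((1 : ℝ) / 8))) := by ring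
      _ ≤ c ^ (8 * k + 8) := hβ
      _ = c ^ (8 * k + 8) * 1 := (mul_one _).symm
  have h2 : Real.exp (-(c * β ^ ((1 : ℝ) / 8))) * β ^ k ≤ β⁻¹ := by
    rw [← one_div, le_div_iff₀ hβ0]
    calc Real.exp (-(c * β ^ ((1 : ℝ) / 8))) * β ^ k * β = β ^ (k + 1) * Real.exp (-(c * β ^ ((1 : ℝ) / 8))) := by ring
      _ ≤ 1 := h1
  have h3 : β⁻¹ ≤ β ^ (-((3 : ℝ) / 4)) := by
    rw [← Real.rpow_neg_one]
    exact Real.rpow_le_rpow_of_exponent_le hβ1 (by norm_num)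
  exact h2.trans h3

/-- `(√β)^m ≤ β^m` and `β^{1/3}`-type crude bounds: for `β ≥ 1`, `Real.sqrt β ≤ β`. [folklore] -/
theorem sqrt_le_self_of_one_le {β : ℝ} (hβ : 1 ≤ β) : Real.sqrt β ≤ β := by
  have h := Real.sqrt_le_sqrt (show β ≤ β ^ 2 by nlinarith)
  rwa [Real.sqrt_sq (by linarith)] at h

end Decay

/-! ## §2 The slow-window numerology at `T = β^{1/8}`, `D = T/(4β)`, `ε = (√β)⁻¹` -/

variable {L : ℕ} [NeZero L]

set_option maxHeartbeats 1600000 in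
/-- ★ **Slow-window numerology.**  For `D_w ≥ 0`, eventually in `β`, every `u` with `orbitDist u < D_w·recordDelta1 L (1/6) β` satisfies, with `T = β^{1/8}`, `r_T = √(T/β)`, `D = T/(4β)`,
`ε = (√β)⁻¹`: `12L³orbitDist u⁴ < 2`, the `hsmall`/`htwo`/`hTD` conditions of `slow_core_tail_le`, and `√β·(3·orbitDist u) ≤ 3(14D_w/|Site|)·β`; also `β ≥ 900`, `(√β)⁻¹ ≤ 2`,
`β·((√β)⁻¹)² ≤ 1`. [folklore] -/
theorem slow_window_numerology {Dw : ℝ} (hDw : 0 ≤ Dw) :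
    ∀ᶠ β : ℝ in atTop, 900 ≤ β ∧ (Real.sqrt β)⁻¹ ≤ 2 ∧ β * (Real.sqrt β)⁻¹ ^ 2 ≤ 1 ∧ 0 ≤ β ^ ((1 : ℝ) / 8) / (4 * β) ∧
      Real.exp (-(β * (β ^ ((1 : ℝ) / 8) / (4 * β)) / 2)) = Real.exp (-(β ^ ((1 : ℝ) / 8) / 8)) ∧
      ∀ u : GaugeConfig 3 1 SU2, orbitDist u < Dw * recordDelta1 L (1 / 6) β →
        (L : ℝ) ^ 3 * (12 * orbitDist u ^ 4) < 2 ∧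
        3 * L * (Real.sqrt (β ^ ((1 : ℝ) / 8) / (4 * β)) + 4 * (Real.sqrt 2 * Real.sqrt (β ^ ((1 : ℝ) / 8) / β) + orbitDist u) +
          Real.sqrt 2 * (Real.sqrt (β ^ ((1 : ℝ) / 8) / β) + Real.sqrt (β ^ ((1 : ℝ) / 8) / β))) < 1 ∧
        9 * L * (Real.sqrt (β ^ ((1 : ℝ) / 8) / (4 * β)) + 4 * (Real.sqrt 2 * Real.sqrt (β ^ ((1 : ℝ) / 8) / β) + orbitDist u) +
          Real.sqrt 2 * (Real.sqrt (β ^ ((1 : ℝ) / 8) / β) + Real.sqrt (β ^ ((1 : ℝ) / 8) / β))) + (Real.sqrt β)⁻¹ ≤ 2 ∧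
        β * (2 * (β ^ ((1 : ℝ) / 8) / (4 * β)) + 8 * (Fintype.card (Edge 3 L) : ℝ) * orbitDist u ^ 2 *
          ((9 * L * (Real.sqrt (β ^ ((1 : ℝ) / 8) / (4 * β)) + Real.sqrt 2 * (Real.sqrt (β ^ ((1 : ℝ) / 8) / β) + Real.sqrt (β ^ ((1 : ℝ) / 8) / β))) + (Real.sqrt β)⁻¹) *
              (1 + 18 * L * (Real.sqrt 2 * Real.sqrt (β ^ ((1 : ℝ) / 8) / β) + orbitDist u) + (18 * L * (Real.sqrt 2 * Real.sqrt (β ^ ((1 : ℝ) / 8) / β) + orbitDist u)) ^ 2) +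
            (18 * L * (Real.sqrt 2 * Real.sqrt (β ^ ((1 : ℝ) / 8) / β) + orbitDist u)) ^ 2 * (36 * L * (Real.sqrt 2 * Real.sqrt (β ^ ((1 : ℝ) / 8) / β) + orbitDist u))) ^ 2) ≤
          β ^ ((1 : ℝ) / 8) ∧
        Real.sqrt β * (3 * orbitDist u) ≤ 3 * (Dw * 14 / Fintype.card (Site 3 L)) * β := by
  have hN := card_site_pos (L := L)
  have hL0 : (0 : ℝ) ≤ L := Nat.cast_nonneg _
  set cδ : ℝ := Dw * 14 / Fintype.card (Site 3 L) with hcδ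
  have hcδ0 : 0 ≤ cδ := by rw [hcδ]; positivity
  -- the constants of the `Φ` bound
  set x₀ : ℝ := 18 * L * (Real.sqrt 2 + 1) with hx₀
  set Q : ℝ := 1 + x₀ + x₀ ^ 2 with hQ
  set g₁ : ℝ := 9 * L * (1 + 2 * Real.sqrt 2) + 1 with hg₁
  set g₂ : ℝ := 36 * 18 ^ 2 * L ^ 3 * 4 * (2 * Real.sqrt 2 + cδ ^ 3) with hg₂
  set M : ℝ := g₁ * Q + g₂ with hM
  have hs2 : (1 : ℝ) ≤ Real.sqrt 2 := Real.one_le_sqrt.mpr (by norm_num)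
  have hx₀0 : 0 ≤ x₀ := by rw [hx₀]; positivity
  have hQ1 : 1 ≤ Q := by rw [hQ]; linarith only [hx₀0, sq_nonneg x₀]
  have hg₁0 : 0 ≤ g₁ := by rw [hg₁]; positivity
  have hg₂0 : 0 ≤ g₂ := by rw [hg₂]; positivity
  have hM0 : 0 ≤ M := by rw [hM]; positivity
  -- `a = r_T → 0`, `b = δ₁ → 0`
  have ha : Tendsto (fun β : ℝ => Real.sqrt (β ^ ((1 : ℝ) / 8) / β)) atTop (𝓝 0) := by
    refine (tendsto_rpow_neg_atTop (show (0 : ℝ) < 7 / 16 by norm_num)).congr' ?_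
    filter_upwards [Filter.eventually_gt_atTop (0 : ℝ)] with β hβ
    rw [sqrt_rpow_eighth_div hβ]
  have hb : Tendsto (fun β : ℝ => Dw * recordDelta1 L (1 / 6) β) atTop (𝓝 0) := by
    have h := ((tendsto_powScale (σ := 1 / 6) (by norm_num)).const_mul 14).div_const (Fintype.card (Site 3 L) : ℝ) |>.const_mul Dw
    simp only [mul_zero, zero_div] at h
    refine h.congr' (Filter.Eventually.of_forall fun β => ?_)
    unfold recordDelta1; ring
  -- the linear smallness: `9L((1+6√2)a + 4b) + a → 0`
  have hlin : Tendsto (fun β : ℝ => 9 * L * ((1 + 6 * Real.sqrt 2) * Real.sqrt (β ^ ((1 : ℝ) / 8) / β) + 4 * (Dw * recordDelta1 L (1 / 6) β)) + Real.sqrt (β ^ ((1 : ℝ) / 8) / β))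
      atTop (𝓝 0) := by
    have h := (((ha.const_mul (1 + 6 * Real.sqrt 2)).add (hb.const_mul 4)).const_mul (9 * (L : ℝ))).add ha
    simpa using h
  have h12 : Tendsto (fun β : ℝ => (L : ℝ) ^ 3 * (12 * (Dw * recordDelta1 L (1 / 6) β) ^ 4)) atTop (𝓝 0) := by
    have h := ((hb.pow 4).const_mul 12).const_mul ((L : ℝ) ^ 3)
    simp only [zero_pow (by norm_num : (4 : ℕ) ≠ 0), mul_zero] at h
    exact h
  -- the `hTD` budget `16|E|c_δ²M²β^{-5/24} ≤ 1`
  have hTDt : Tendsto (fun β : ℝ => 16 * (Fintype.card (Edge 3 L) : ℝ) * cδ ^ 2 * M ^ 2 * β ^ (-((5 : ℝ) / 24))) atTop (𝓝 0) := by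
    have h := (tendsto_rpow_neg_atTop (show (0 : ℝ) < 5 / 24 by norm_num)).const_mul (16 * (Fintype.card (Edge 3 L) : ℝ) * cδ ^ 2 * M ^ 2)
    simpa using h
  filter_upwards [Filter.eventually_ge_atTop (900 : ℝ), ha.eventually (eventually_le_nhds (show (0 : ℝ) < 1 by norm_num)),
    hb.eventually (eventually_le_nhds (show (0 : ℝ) < 1 by norm_num)), hlin.eventually (eventually_lt_nhds (show (0 : ℝ) < 1 by norm_num)),
    h12.eventually (eventually_lt_nhds (show (0 : ℝ) < 2 by norm_num)), hTDt.eventually (eventually_le_nhds (show (0 : ℝ) < 1 by norm_num))]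
    with β hβ ha1 hb1 hlin1 h12' hTD1
  obtain ⟨hs0, hs30, hs1, hβs, hβ0⟩ := inv_sqrt_window hβ
  have hβ1 : 1 ≤ β := by linarith
  set a : ℝ := Real.sqrt (β ^ ((1 : ℝ) / 8) / β) with hadef
  set b : ℝ := Dw * recordDelta1 L (1 / 6) β with hbdef
  set T : ℝ := β ^ ((1 : ℝ) / 8) with hT
  have hT1 : 1 ≤ T := Real.one_le_rpow hβ1 (by norm_num)
  have hT0 : 0 < T := by linarith
  have ha0 : 0 ≤ a := Real.sqrt_nonneg _
  have hb0 : 0 ≤ b := by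
    rw [hbdef]; unfold recordDelta1; exact mul_nonneg hDw (div_nonneg (by linarith [powScale_pos (1 / 6) β]) hN.le)
  have ha2 : a ^ 2 = T / β := Real.sq_sqrt (by positivity)
  have hD0 : 0 ≤ T / (4 * β) := by positivity
  have hsD : Real.sqrt (T / (4 * β)) ≤ a := Real.sqrt_le_sqrt (by rw [div_le_div_iff₀ (by positivity) hβ0]; linarith only [mul_pos hT0 hβ0])
  -- `ε = s ≤ a`: `β^{-1/2} ≤ β^{-7/16}`
  have hεa : (Real.sqrt β)⁻¹ ≤ a := by
    rw [hadef, sqrt_rpow_eighth_div hβ0, Real.sqrt_eq_rpow, ← Real.rpow_neg hβ0.le]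
    exact Real.rpow_le_rpow_of_exponent_le hβ1 (by norm_num)
  -- `b = c_δ β^{-1/6}`, `b³ ≤ c_δ³ a`, `√β b = c_δ β^{1/3} ≤ c_δ β`
  have hbe : b = cδ * β ^ (-((1 : ℝ) / 6)) := by
    rw [hbdef, hcδ]; unfold recordDelta1; rw [powScale_eq hβ1]; field_simp
  have hb3 : b ^ 3 ≤ cδ ^ 3 * a := by
    rw [hbe, mul_pow, ← Real.rpow_natCast (β ^ (-((1 : ℝ) / 6))) 3, ← Real.rpow_mul hβ0.le, hadef, sqrt_rpow_eighth_div hβ0]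
    refine mul_le_mul_of_nonneg_left ?_ (by positivity)
    rw [show (-((1 : ℝ) / 6) * ((3 : ℕ) : ℝ)) = -((1 : ℝ) / 2) by norm_num]
    exact Real.rpow_le_rpow_of_exponent_le hβ1 (by norm_num)
  have hsb : Real.sqrt β * (3 * b) ≤ 3 * cδ * β := by
    have h1 : Real.sqrt β ≤ β := sqrt_le_self_of_one_le hβ1
    have h2 : b ≤ cδ := by
      rw [hbe]; exact mul_le_of_le_one_right hcδ0 (Real.rpow_le_one_of_one_le_of_nonpos hβ1 (by norm_num))
    linarith only [mul_le_mul h1 h2 hb0 (by linarith)]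
  refine ⟨hβ, by linarith, by rw [hβs], hD0, ?_, fun u hu => ?_⟩
  · congr 1; field_simp; try ring
  have hτ0 : 0 ≤ orbitDist u := orbitDist_nonneg u
  have hτb : orbitDist u ≤ b := hu.le
  have hτ1 : orbitDist u ≤ 1 := hτb.trans hb1
  refine ⟨?_, ?_, ?_, ?_, ?_⟩
  · exact lt_of_le_of_lt (mul_le_mul_of_nonneg_left (mul_le_mul_of_nonneg_left (pow_le_pow_left₀ hτ0 hτb 4) (by norm_num)) (by positivity)) h12'
  · -- `3L(…) ≤ 3L((1+6√2)a + 4b) < 1`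
    have h : Real.sqrt (T / (4 * β)) + 4 * (Real.sqrt 2 * a + orbitDist u) + Real.sqrt 2 * (a + a) ≤ (1 + 6 * Real.sqrt 2) * a + 4 * b := by linarith only [hsD, hτb]
    have h3 : 3 * (L : ℝ) * ((1 + 6 * Real.sqrt 2) * a + 4 * b) ≤ 9 * L * ((1 + 6 * Real.sqrt 2) * a + 4 * b) + a := by
      have : 0 ≤ (L : ℝ) * ((1 + 6 * Real.sqrt 2) * a + 4 * b) := by positivity
      linarith only [this, ha0]
    calc 3 * (L : ℝ) * (Real.sqrt (T / (4 * β)) + 4 * (Real.sqrt 2 * a + orbitDist u) + Real.sqrt 2 * (a + a)) ≤ 3 * L * ((1 + 6 * Real.sqrt 2) * a + 4 * b) :=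
          mul_le_mul_of_nonneg_left h (by positivity)
      _ < 1 := by linarith only [h3, hlin1]
  · have h : Real.sqrt (T / (4 * β)) + 4 * (Real.sqrt 2 * a + orbitDist u) + Real.sqrt 2 * (a + a) ≤ (1 + 6 * Real.sqrt 2) * a + 4 * b := by linarith only [hsD, hτb]
    have := mul_le_mul_of_nonneg_left h (by positivity : (0 : ℝ) ≤ 9 * L)
    linarith only [this, hεa, hlin1]
  · -- `hTD`: `Φ ≤ M a`, `β b² M² a² = c_δ² M² β^{-5/24}`
    set x : ℝ := 18 * L * (Real.sqrt 2 * a + orbitDist u) with hx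
    have hx0 : 0 ≤ x := by rw [hx]; positivity
    have hxx₀ : x ≤ x₀ := by
      rw [hx, hx₀]
      have h1 := mul_le_mul_of_nonneg_left ha1 (by positivity : (0 : ℝ) ≤ 18 * L * Real.sqrt 2)
      have h2 := mul_le_mul_of_nonneg_left hτ1 (by positivity : (0 : ℝ) ≤ 18 * L)
      linarith only [h1, h2]
    have hQ' : 1 + x + x ^ 2 ≤ Q := by
      rw [hQ]; have := pow_le_pow_left₀ hx0 hxx₀ 2; linarith only [this, hxx₀]
    have hfirst : 9 * L * (Real.sqrt (T / (4 * β)) + Real.sqrt 2 * (a + a)) + (Real.sqrt β)⁻¹ ≤ g₁ * a := by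
      rw [hg₁]
      have h1 := mul_le_mul_of_nonneg_left hsD (by positivity : (0 : ℝ) ≤ 9 * L)
      linarith only [h1, hεa]
    have hfirst0 : 0 ≤ 9 * L * (Real.sqrt (T / (4 * β)) + Real.sqrt 2 * (a + a)) + (Real.sqrt β)⁻¹ := by positivity
    have hcube : (Real.sqrt 2 * a + orbitDist u) ^ 3 ≤ 4 * (2 * Real.sqrt 2 + cδ ^ 3) * a := by
      have hp : (Real.sqrt 2 * a + orbitDist u) ^ 3 ≤ 4 * ((Real.sqrt 2 * a) ^ 3 + orbitDist u ^ 3) := by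
        have hpa : 0 ≤ Real.sqrt 2 * a := mul_nonneg (Real.sqrt_nonneg 2) ha0
        linarith only [mul_nonneg (add_nonneg hpa hτ0) (sq_nonneg (Real.sqrt 2 * a - orbitDist u))]
      have hs22 : Real.sqrt 2 ^ 2 = 2 := Real.sq_sqrt (by norm_num)
      have h1 : (Real.sqrt 2 * a) ^ 3 ≤ 2 * Real.sqrt 2 * a := by
        have ha3 : a ^ 3 ≤ a := by
          have ha2 : a ^ 2 ≤ 1 := by nlinarith only [ha0, ha1]
          calc a ^ 3 = a ^ 2 * a := by ring
            _ ≤ 1 * a := mul_le_mul_of_nonneg_right ha2 ha0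
            _ = a := one_mul a
        calc (Real.sqrt 2 * a) ^ 3 = Real.sqrt 2 ^ 2 * Real.sqrt 2 * a ^ 3 := by ring
          _ ≤ Real.sqrt 2 ^ 2 * Real.sqrt 2 * a := mul_le_mul_of_nonneg_left ha3 (by positivity)
          _ = 2 * Real.sqrt 2 * a := by rw [hs22]
      have h2 : orbitDist u ^ 3 ≤ cδ ^ 3 * a := (pow_le_pow_left₀ hτ0 hτb 3).trans hb3
      linarith only [hp, h1, h2]
    have hlast : x ^ 2 * (36 * L * (Real.sqrt 2 * a + orbitDist u)) ≤ g₂ * a := by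
      rw [hx, hg₂]
      have : (18 * L * (Real.sqrt 2 * a + orbitDist u)) ^ 2 * (36 * L * (Real.sqrt 2 * a + orbitDist u)) = 36 * 18 ^ 2 * L ^ 3 * (Real.sqrt 2 * a + orbitDist u) ^ 3 := by ring
      rw [this]
      have := mul_le_mul_of_nonneg_left hcube (by positivity : (0 : ℝ) ≤ 36 * 18 ^ 2 * L ^ 3)
      linarith only [this]
    have hΦ : (9 * L * (Real.sqrt (T / (4 * β)) + Real.sqrt 2 * (a + a)) + (Real.sqrt β)⁻¹) * (1 + x + x ^ 2) + x ^ 2 * (36 * L * (Real.sqrt 2 * a + orbitDist u)) ≤ M * a := by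
      rw [hM]
      have h1 := mul_le_mul hfirst hQ' (by positivity) (by positivity)
      have e : (g₁ * Q + g₂) * a = g₁ * a * Q + g₂ * a := by ring
      rw [e]; linarith only [h1, hlast]
    have hΦ0 : 0 ≤ (9 * L * (Real.sqrt (T / (4 * β)) + Real.sqrt 2 * (a + a)) + (Real.sqrt β)⁻¹) * (1 + x + x ^ 2) + x ^ 2 * (36 * L * (Real.sqrt 2 * a + orbitDist u)) := by
      positivity
    have hΦsq : ((9 * L * (Real.sqrt (T / (4 * β)) + Real.sqrt 2 * (a + a)) + (Real.sqrt β)⁻¹) * (1 + x + x ^ 2) + x ^ 2 * (36 * L * (Real.sqrt 2 * a + orbitDist u))) ^ 2 ≤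
        M ^ 2 * a ^ 2 := by rw [← mul_pow]; exact pow_le_pow_left₀ hΦ0 hΦ 2
    -- `β b² a² M² = c_δ² M² β^{-5/24}`
    have hkey : β * b ^ 2 * (M ^ 2 * a ^ 2) = cδ ^ 2 * M ^ 2 * β ^ (-((5 : ℝ) / 24)) := by
      rw [ha2, hbe, hT, mul_pow, ← Real.rpow_natCast (β ^ (-((1 : ℝ) / 6))) 2, ← Real.rpow_mul hβ0.le]
      have e1 : β * (cδ ^ 2 * β ^ (-((1 : ℝ) / 6) * ((2 : ℕ) : ℝ))) * (M ^ 2 * (β ^ ((1 : ℝ) / 8) / β)) = cδ ^ 2 * M ^ 2 * (β ^ (-((1 : ℝ) / 6) * ((2 : ℕ) : ℝ)) * β ^ ((1 : ℝ) / 8)) := by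
        field_simp
      have hexp : (-((1 : ℝ) / 6) * ((2 : ℕ) : ℝ) + (1 : ℝ) / 8) = -((5 : ℝ) / 24) := by norm_num
      rw [e1, ← Real.rpow_add hβ0, hexp]
    have hτ2 : orbitDist u ^ 2 ≤ b ^ 2 := pow_le_pow_left₀ hτ0 hτb 2
    have hmain : 8 * (Fintype.card (Edge 3 L) : ℝ) * orbitDist u ^ 2 *
        ((9 * L * (Real.sqrt (T / (4 * β)) + Real.sqrt 2 * (a + a)) + (Real.sqrt β)⁻¹) * (1 + x + x ^ 2) + x ^ 2 * (36 * L * (Real.sqrt 2 * a + orbitDist u))) ^ 2 ≤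
        8 * (Fintype.card (Edge 3 L) : ℝ) * b ^ 2 * (M ^ 2 * a ^ 2) :=
      mul_le_mul (mul_le_mul_of_nonneg_left hτ2 (by positivity)) hΦsq (sq_nonneg _) (by positivity)
    have h2D : β * (2 * (T / (4 * β))) = T / 2 := by field_simp; try ring
    have hfin : β * (8 * (Fintype.card (Edge 3 L) : ℝ) * b ^ 2 * (M ^ 2 * a ^ 2)) ≤ T / 2 := by
      have e : β * (8 * (Fintype.card (Edge 3 L) : ℝ) * b ^ 2 * (M ^ 2 * a ^ 2)) = 8 * (Fintype.card (Edge 3 L) : ℝ) * (β * b ^ 2 * (M ^ 2 * a ^ 2)) := by ring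
      rw [e, hkey]
      have : 16 * (Fintype.card (Edge 3 L) : ℝ) * cδ ^ 2 * M ^ 2 * β ^ (-((5 : ℝ) / 24)) ≤ T := hTD1.trans hT1
      linarith only [this]
    calc β * (2 * (T / (4 * β)) + 8 * (Fintype.card (Edge 3 L) : ℝ) * orbitDist u ^ 2 *
          ((9 * L * (Real.sqrt (T / (4 * β)) + Real.sqrt 2 * (a + a)) + (Real.sqrt β)⁻¹) * (1 + x + x ^ 2) + x ^ 2 * (36 * L * (Real.sqrt 2 * a + orbitDist u))) ^ 2)
        = β * (2 * (T / (4 * β))) + β * (8 * (Fintype.card (Edge 3 L) : ℝ) * orbitDist u ^ 2 *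
          ((9 * L * (Real.sqrt (T / (4 * β)) + Real.sqrt 2 * (a + a)) + (Real.sqrt β)⁻¹) * (1 + x + x ^ 2) + x ^ 2 * (36 * L * (Real.sqrt 2 * a + orbitDist u))) ^ 2) := by ring
      _ ≤ T / 2 + T / 2 := add_le_add (le_of_eq h2D) ((mul_le_mul_of_nonneg_left hmain hβ0.le).trans hfin)
      _ = T := by ring
  · calc Real.sqrt β * (3 * orbitDist u) ≤ Real.sqrt β * (3 * b) := mul_le_mul_of_nonneg_left (by linarith) (Real.sqrt_nonneg _)
      _ ≤ 3 * cδ * β := hsb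

end Summit.QuantumFields.YangMills.Theorems.FemtoTransferGap.RateTube

end
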